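import Summits.QuantumFields.YangMills.Theorems.UnitScaleTiltHistoryTailCoreRunRows
import Summits.QuantumFields.YangMills.Theorems.AlphaInputsT3ACv3LaneChi
import HarnessLib

/-!
# `AlphaInputsT3ACv4Lane` — THE VERSION-4 (α) RUN PACKAGES OF THE T³∕AC ROUTE: version 3 with the COMB (67)-row `hLF67` REPLACED by the CURRENCY-FREE (71)-row `h71`
# «(71) per recorded large-field plaquette» (★★OWNER RULING g26-№14: R-ii executed at the package by additive twins; P1 of the v4 package plan, bill v1.2 §7) —
# lane `pub-balaban3d`, width seat alpha-2 (g7)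

WHY (cell `ym3-torus`, route `UnitScaleTilt`, crux `HistoryTailL` = stmt-QuantumFields-19936; this seat's NODE-O d = 3 bill v1.2 §6 L4 ∕ §7; ★w6-19936 g2's LOCATE
`LOCATE-alpha-seam-w6-g2.md` = evidence #60).  In the v3 packages (`AlphaV3AC.RunAlphaV3AC`∕`RunAlphaV3CoreAC`∕`RunAlphaV3ChiAC`) the row `hLF67` asks (67)-largeness of the
handed minimiser map in the [B7] COMB currency `‖hol (avgIter L (liftCfg U_k(h,U)) j) − 1‖` at the SAME threshold `g_j p(g_j)` the history masses use to RECORD largeness of the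
SYMMETRICALLY averaged variable — a margin-0 comparison no supplier can meet for print's map (located ✗).  The ONLY readers of `hLF67` in the route are the two (71)-per-plaquette
theorems (`AlphaV3AC.eq71_perPlaquette_of_alphaV3`, `…_of_alphaV3Core`), i.e. (71) is what the route actually consumes.  VERSION 4 therefore carries (71) ITSELF as the row:
* §1 `AlphaV4AC.RunAlphaV4CoreAC` ∕ `RunAlphaV4ChiAC` — `RunAlphaV3CoreAC` ∕ `RunAlphaV3ChiAC` VERBATIM (same step packages `StepAlphaV3CoreAC` ∕ `StepAlphaV3ChiAC`, same `h68`) with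
  `hLF67 ↦ h71`, `h71` = VERBATIM the conclusion of `eq71_perPlaquette_of_alphaV3Core` (reads the FINE plaquettes of `U_k(h,U)` on the torus region `regionT e` of the recorded
  plaquette `e` — no averaging, no currency); `RunAlphaV4ChiAC.toCore`.
* §2 v3 ⇒ v4 (nothing landed is lost): ★ `AlphaV3AC.RunAlphaV3CoreAC.toV4` ∕ `AlphaV3AC.RunAlphaV3ChiAC.toV4` on the lane's `≤`-family (`S.g²ε₀ ≤ (min γ₀ 1)²`, `2 ≤ L`) by
  `eq71_perPlaquette_of_alphaV3Core`; and the T³ instances `…toV4_T3` (the window is `T3Scales_window`, `2 ≤ F.L` is `F.hL`).  v4 ⇒ v3 is false in general (that is the point).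
* §3 the (71) row READ BACK in the shape the consumers use (`AlphaV4AC.eq71_perPlaquette_of_alphaV4Core` = the field; stated so that the v3 consumers' call sites port by renaming).
HONEST FRAMING.  `structure … : Prop` below are HYPOTHESIS SCHEMAS (never asserted); the theorems are field bookkeeping + one call of the landed (69)–(71) derivation.  Nothing of
[Balaban1985UV3]'s cluster expansion is proved; the v3 packages, records and doors stay in the tree unchanged (the v3 line is BANKED, RULING g26-№14 (b)); count-neutral helper
toward 2′χ (`--supports stmt-QuantumFields-19936`); registry untouched (the v5p10 skeleton with `stub_laneRecordsV4Chi` is LEAD's later crux-workfile act).  YM₃ on the three-torus is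
rung R3 of the programme, not the Clay problem: nothing here is about d = 4, infinite volume, or a mass gap.

References: T. Bałaban, Commun. Math. Phys. 102 (1985) 255–275 [Balaban1985UV3] ((67)–(71) p.273, Thm 2 p.272, (41) p.266); Commun. Math. Phys. 98 (1985) 17–51
[Balaban1985Averaging] ((42)–(43) p.23–24).
-/

set_option autoImplicit false

noncomputable section

namespace Summit.QuantumFields.YangMills.Theorems

open MeasureTheory
open scoped BigOperators Matrix.Norms.L2Operator
open Literature.MathematicalPhysics.QuantumFieldTheory.Balaban1983to89
open Literature.MathematicalPhysics.QuantumFieldTheory.Balaban1983to89.T3ContinuumYM3Torus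
open Literature.MathematicalPhysics.QuantumFieldTheory.Balaban1983to89.B10 (pFun)
open Literature.MathematicalPhysics.QuantumFieldTheory.Balaban1983to89.T3UnitLawDensityEML (ℰp)
open Literature.MathematicalPhysics.QuantumFieldTheory.Balaban1983to89.T3UnitScaleTilt (θBal)
open Literature.MathematicalPhysics.QuantumFieldTheory.Balaban1983to89.T3AlphaInputsAC
open Literature.MathematicalPhysics.QuantumFieldTheory.Balaban1985CMP102
open Literature.MathematicalPhysics.QuantumFieldTheory.Balaban1985CMP102.Setting
open Summit.QuantumFields.Balaban3D.Carriers
open Summit.QuantumFields.Balaban3D.Proofs.Primitives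
open Summit.QuantumFields.Balaban3D.Proofs.GroupModelLieC (lieC)
open Summit.QuantumFields.Balaban3D.Proofs.TowerAC
open Summit.QuantumFields.Balaban3D.Proofs.StandardAC
open Summit.QuantumFields.Balaban3D.Proofs.InputsAC
open Summit.QuantumFields.Balaban3D.Proofs.AlphaAC (AlphaDataAC)
open Summit.QuantumFields.Balaban3D.Proofs.LiftBridge (liftCfg)
open Summit.QuantumFields.Balaban3D.Proofs.Run3SmallFactors (codeZ regionT)
open B7Prop1Local (pdevOn loK plaqHiK)

namespace AlphaV4AC

variable {L : ℕ}

/-! ## §1 The version-4 run packages: (71) per recorded plaquette in place of the comb (67)-row -/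

section Alpha

variable {S : Scales L} {G : Type} [GaugeGroup G] [MeasurableSpace G] [HaarData G] (𝔊 : GroupModel G) (𝔠 : AlphaConsts L 𝔊.N)
  (X : ExternalInputsAC S G) (𝔖 : ∀ k, StepSeries S G ↥(lieC 𝔊) (nblkOf S 𝔠.lane.carrier k) k) (𝔄 : AlphaDataAC 𝔊 𝔠 X 𝔖)
  (win : (k : ℕ) → Hist S.P (k + 1) → Set (GaugeField S.P (k + 1) G))

/-- **THE VERSION-4 DATA CORE OF THE (α) INPUTS OF ONE LATTICE APPROXIMATION**: `AlphaV3AC.RunAlphaV3CoreAC` VERBATIM (core step inputs for every `k < K`, (68) about the lifted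
composite minimisers) EXCEPT that the comb (67)-row `hLF67` is replaced by **`h71` — (71) PER RECORDED LARGE-FIELD PLAQUETTE**: for `k ≤ K`, an admissible history `h`, every field
`U` and every recorded `e = (j, code p′) ∈ P(h)`, `p(g_j)²∕4 ≤ N·((1∕g_k²)·Σ_{q ∈ Δ′(e)} η_k⁻¹[1 − re tr U_k(h,U)(∂q)])` (the text of `AlphaV3AC.eq71_perPlaquette_of_alphaV3Core`'s conclusion;
what (67) + (68) are used for in print, p.273 L11–22; currency-free: it reads fine plaquettes only).  HYPOTHESES. [cite: Balaban1985UV3, (67)–(71) p.273 + pp.273–274] -/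
structure RunAlphaV4CoreAC : Prop where
  /-- the step inputs (version-3 core step package, unchanged) -/
  steps : ∀ k, k + 1 ≤ S.K → AlphaV3AC.StepAlphaV3CoreAC 𝔊 𝔠 X 𝔖 𝔄 win k
  /-- (71) per recorded large-field plaquette, on the composite minimisers -/
  h71 : ∀ k, k ≤ S.K → ∀ (h : Hist S.P k), Hist.Admissible 𝔠.lane.carrier.M₁ (rcolOf S 𝔠.lane.carrier) k h →
    ∀ (U : GaugeField S.P k G) (e : ℕ × PlaqCode S.P), e ∈ Hist.disc h →
      B10.pFun 𝔠.lane.carrier.b₀ 𝔠.lane.carrier.p₀ (S.gk e.1) ^ 2 / 4 ≤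
        (𝔊.N : ℝ) * ((S.gk k)⁻¹ ^ 2 * ∑ q ∈ regionT e, (S.eta k)⁻¹ * (1 - reTr (GaugeField.plaqHol (X.UkH k h U) q)))
  /-- (68) on the lifted minimizers (unchanged) -/
  h68 : ∀ k, k ≤ S.K → ∀ (h : Hist S.P k), Hist.Admissible 𝔠.lane.carrier.M₁ (rcolOf S 𝔠.lane.carrier) k h →
    ∀ (U : GaugeField S.P k G), ∀ e ∈ Hist.disc h,
      pdevOn (loK L e.1 (codeZ e)) (plaqHiK L e.1 (codeZ e) e.2.2.1 e.2.2.2) (liftCfg 𝔊 (X.UkH k h U)) <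
        𝔠.C68 * (S.gk e.1 * pFun 𝔠.lane.carrier.b₀ 𝔠.lane.carrier.p₀ (S.gk e.1)) * (((L : ℝ) ^ e.1)⁻¹) ^ 2

/-- **THE VERSION-4 (α) INPUTS WITH PRINT'S LOWER ROW** (the χ-record): `AlphaV3AC.RunAlphaV3ChiAC` VERBATIM (χ step packages `StepAlphaV3ChiAC`, (68)) with `hLF67 ↦ h71`.  The run
package of the v4 χ-socket `OfV4ChiAt` ∕ `AlphaInputsT3ACv4RecChi` (P2 of the plan).  HYPOTHESES. [cite: Balaban1985UV3, (67)–(71) p.273 + (47) p.267 + p.272 L32–33] -/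
structure RunAlphaV4ChiAC : Prop where
  /-- the step inputs (version-3 χ step package, unchanged) -/
  steps : ∀ k, k + 1 ≤ S.K → AlphaV3AC.StepAlphaV3ChiAC 𝔊 𝔠 X 𝔖 𝔄 win k
  /-- (71) per recorded large-field plaquette, on the composite minimisers -/
  h71 : ∀ k, k ≤ S.K → ∀ (h : Hist S.P k), Hist.Admissible 𝔠.lane.carrier.M₁ (rcolOf S 𝔠.lane.carrier) k h →
    ∀ (U : GaugeField S.P k G) (e : ℕ × PlaqCode S.P), e ∈ Hist.disc h →
      B10.pFun 𝔠.lane.carrier.b₀ 𝔠.lane.carrier.p₀ (S.gk e.1) ^ 2 / 4 ≤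
        (𝔊.N : ℝ) * ((S.gk k)⁻¹ ^ 2 * ∑ q ∈ regionT e, (S.eta k)⁻¹ * (1 - reTr (GaugeField.plaqHol (X.UkH k h U) q)))
  /-- (68) on the lifted minimizers (unchanged) -/
  h68 : ∀ k, k ≤ S.K → ∀ (h : Hist S.P k), Hist.Admissible 𝔠.lane.carrier.M₁ (rcolOf S 𝔠.lane.carrier) k h →
    ∀ (U : GaugeField S.P k G), ∀ e ∈ Hist.disc h,
      pdevOn (loK L e.1 (codeZ e)) (plaqHiK L e.1 (codeZ e) e.2.2.1 e.2.2.2) (liftCfg 𝔊 (X.UkH k h U)) <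
        𝔠.C68 * (S.gk e.1 * pFun 𝔠.lane.carrier.b₀ 𝔠.lane.carrier.p₀ (S.gk e.1)) * (((L : ℝ) ^ e.1)⁻¹) ^ 2

variable {𝔊 𝔠 X 𝔖 𝔄 win}

/-- The v4 χ-record projects to the v4 core. [folklore] -/
theorem RunAlphaV4ChiAC.toCore (R : RunAlphaV4ChiAC 𝔊 𝔠 X 𝔖 𝔄 win) : RunAlphaV4CoreAC 𝔊 𝔠 X 𝔖 𝔄 win :=
  ⟨fun k hk => (R.steps k hk).toStepAlphaV3CoreAC, R.h71, R.h68⟩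

/-- **THE (71) ROW READ BACK** in the shape of `AlphaV3AC.eq71_perPlaquette_of_alphaV3Core` (so the v3 consumers' call sites port by renaming; the `≤`-window and `2 ≤ L` binders are
kept, unused, for a byte-compatible signature). [cite: Balaban1985UV3, (71) p.273] -/
theorem eq71_perPlaquette_of_alphaV4Core (_hle : S.g ^ 2 * S.ε₀ ≤ (min 𝔠.gamma0 1) ^ 2) (_hL : 2 ≤ L) (R : RunAlphaV4CoreAC 𝔊 𝔠 X 𝔖 𝔄 win) (k : ℕ)
    (hk : k ≤ S.K) (h : Hist S.P k) (hh : Hist.Admissible 𝔠.lane.carrier.M₁ (rcolOf S 𝔠.lane.carrier) k h) (U : GaugeField S.P k G) (e : ℕ × PlaqCode S.P)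
    (he : e ∈ Hist.disc h) :
    B10.pFun 𝔠.lane.carrier.b₀ 𝔠.lane.carrier.p₀ (S.gk e.1) ^ 2 / 4 ≤
      (𝔊.N : ℝ) * ((S.gk k)⁻¹ ^ 2 * ∑ q ∈ regionT e, (S.eta k)⁻¹ * (1 - reTr (GaugeField.plaqHol (X.UkH k h U) q))) :=
  R.h71 k hk h hh U e he

end Alpha

end AlphaV4AC

/-! ## §2 Version 3 ⇒ version 4 (nothing landed is lost) -/

namespace AlphaV3AC

section Upgrade

variable {L : ℕ} {S : Scales L} {G : Type} [GaugeGroup G] [MeasurableSpace G] [HaarData G] {𝔊 : GroupModel G} {𝔠 : AlphaConsts L 𝔊.N}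
  {X : ExternalInputsAC S G} {𝔖 : ∀ k, StepSeries S G ↥(lieC 𝔊) (nblkOf S 𝔠.lane.carrier k) k} {𝔄 : AlphaDataAC 𝔊 𝔠 X 𝔖}
  {win : (k : ℕ) → Hist S.P (k + 1) → Set (GaugeField S.P (k + 1) G)}

/-- ★ **v3 ⇒ v4 FOR THE CORE** on the lane's `≤`-family: the comb (67)-row and (68) give (71) per recorded plaquette (`eq71_perPlaquette_of_alphaV3Core` = (69)–(71) through
`PerPlaquette71.perPlaquette71_local_gamma`), every other row is kept. [cite: Balaban1985UV3, (67)–(71) p.273] -/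
theorem RunAlphaV3CoreAC.toV4 (hle : S.g ^ 2 * S.ε₀ ≤ (min 𝔠.gamma0 1) ^ 2) (hL : 2 ≤ L) (R : RunAlphaV3CoreAC 𝔊 𝔠 X 𝔖 𝔄 win) :
    AlphaV4AC.RunAlphaV4CoreAC 𝔊 𝔠 X 𝔖 𝔄 win :=
  ⟨R.steps, fun k hk h hh U e he => eq71_perPlaquette_of_alphaV3Core hle hL R k hk h hh U e he, R.h68⟩

/-- ★ **v3 ⇒ v4 FOR THE χ-RECORD** on the lane's `≤`-family. [cite: Balaban1985UV3, (67)–(71) p.273] -/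
theorem RunAlphaV3ChiAC.toV4 (hle : S.g ^ 2 * S.ε₀ ≤ (min 𝔠.gamma0 1) ^ 2) (hL : 2 ≤ L) (R : RunAlphaV3ChiAC 𝔊 𝔠 X 𝔖 𝔄 win) :
    AlphaV4AC.RunAlphaV4ChiAC 𝔊 𝔠 X 𝔖 𝔄 win :=
  ⟨R.steps, fun k hk h hh U e he => eq71_perPlaquette_of_alphaV3Core hle hL R.toCore k hk h hh U e he, R.h68⟩

/-- **v3 ⇒ v4 FOR THE FULL (non-χ) RECORD's core**: the old record `RunAlphaV3AC` projects to the v4 core (through `toCore`). [cite: Balaban1985UV3, (67)–(71) p.273] -/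
theorem RunAlphaV3AC.toV4Core (hle : S.g ^ 2 * S.ε₀ ≤ (min 𝔠.gamma0 1) ^ 2) (hL : 2 ≤ L) (R : RunAlphaV3AC 𝔊 𝔠 X 𝔖 𝔄 win) :
    AlphaV4AC.RunAlphaV4CoreAC 𝔊 𝔠 X 𝔖 𝔄 win :=
  R.toCore.toV4 hle hL

end Upgrade

/-! ### The T³ instances: the window is `T3Scales_window`, `2 ≤ F.L` is the family's -/

section T3

variable {F : T3Family} {𝔠 : AlphaConsts F.L (suGroupModel 2).N} {γ : ℝ} {hγ : 0 < γ} {hγ1 : γ ≤ (min 𝔠.gamma0 1) ^ 2} {K : ℕ}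
  {X : ExternalInputsAC (T3Scales F γ hγ (hγ1.trans (sq_min_one_le _ 𝔠.gamma0_pos)) K) (Matrix.specialUnitaryGroup (Fin 2) ℂ)}
  {𝔖 : ∀ k, StepSeries (T3Scales F γ hγ (hγ1.trans (sq_min_one_le _ 𝔠.gamma0_pos)) K) (Matrix.specialUnitaryGroup (Fin 2) ℂ) ↥(lieC (suGroupModel 2))
    (nblkOf (T3Scales F γ hγ (hγ1.trans (sq_min_one_le _ 𝔠.gamma0_pos)) K) 𝔠.lane.carrier k) k}
  {𝔄 : AlphaDataAC (suGroupModel 2) 𝔠 X 𝔖}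
  {win : (k : ℕ) → Hist (F.P K) (k + 1) → Set (GaugeField (F.P K) (k + 1) (Matrix.specialUnitaryGroup (Fin 2) ℂ))}

/-- ★ **v3 ⇒ v4 AT THE T³ SCALES, CORE** (hypothesis-free: `T3Scales_window`, `F.hL`). [cite: Balaban1985UV3, (67)–(71) p.273] -/
theorem RunAlphaV3CoreAC.toV4_T3 (R : RunAlphaV3CoreAC (suGroupModel 2) 𝔠 X 𝔖 𝔄 win) : AlphaV4AC.RunAlphaV4CoreAC (suGroupModel 2) 𝔠 X 𝔖 𝔄 win :=
  R.toV4 (T3Scales_window F 𝔠 γ hγ hγ1 K) F.hL.2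

/-- ★ **v3 ⇒ v4 AT THE T³ SCALES, χ-RECORD** (hypothesis-free). [cite: Balaban1985UV3, (67)–(71) p.273] -/
theorem RunAlphaV3ChiAC.toV4_T3 (R : RunAlphaV3ChiAC (suGroupModel 2) 𝔠 X 𝔖 𝔄 win) : AlphaV4AC.RunAlphaV4ChiAC (suGroupModel 2) 𝔠 X 𝔖 𝔄 win :=
  R.toV4 (T3Scales_window F 𝔠 γ hγ hγ1 K) F.hL.2

end T3

end AlphaV3AC

end Summit.QuantumFields.YangMills.Theorems

end
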